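import Summits.FinalStateConjecture.FinalStateConjecture.Theses.StarvedNecks
import Summits.FinalStateConjecture.FinalStateConjecture.Theorems.SwallowTheDatumParametricKerrBurialLine
import Summits.FinalStateConjecture.FinalStateConjecture.Theorems.StarvedNecksHonestFixedRadiusSettlingStubProbePatch
import Summits.FinalStateConjecture.FinalStateConjecture.Theorems.StarvedNecksHonestFixedRadiusSettlingStubThresholdJunction
import Summits.FinalStateConjecture.FinalStateConjecture.Theorems.HonestFixedRadiusSettling.Negative.CoreLoadBearing

/-!
# Route StarvedNecks — crux `HonestFixedRadiusSettling` (stmt-FinalStateConjecture-13550), line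
# `far-field-surgery`: the SECOND reduction — far gluing in the GROWING-MASS schedule of route
# SwallowTheDatum (`FarAnnulusGluing`, stmt-FinalStateConjecture-15427)

Companion of `StarvedNecksHonestFixedRadiusSettlingSurgeryLine.lean` (the reduction
`honestFixedRadiusSettling_of_surgery : FarGluing → StableUnfoldingOneAtlas → crux`, whose far-gluing atom uses
the SHRINKING mass schedule `m R ↓ M₀` with rescaled-`H² × H¹`-small annuli).  Here the far-gluing hypothesis is
stated VERBATIM as the per-datum conclusion of route SwallowTheDatum's item `FarAnnulusGluing`
(stmt-FinalStateConjecture-15427; Mao–Oh–Tao arXiv:2308.13031 Thm 1.7/1.10 at scale `R` onto an exact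
time-symmetric isotropic Schwarzschild end of mass `m R ≥ ηR`, jointly smooth in `(R, x)` — reduced by that crux's
leads to the single unprinted atom `∀ η, IsBump η → GluingFamilyFor η` of
`SwallowTheDatumParametricKerrBurialEngine.lean`), over the tree abbreviations `SmoothSectionsOn`, `AgreeAt`,
`IsExactSchwarzschildBeyond` (definitionally the inlined clauses of 15427), so that ONE parametric gluing atom
serves both routes: when `FarAnnulusGluing_holds` lands, the first hypothesis below is discharged by `exact`.

The price is paid by the core: `honestFixedRadiusSettling_of_farAnnulusGluing` asks, for EVERY far-gluing family
`(η, e, R⋆, m, G)` of the datum in that schedule, an interior probe `(R₀, E, x₀, v₀)` along the SAME end below the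
SAME threshold (`e.R < R₀ < R⋆`; breathing probes live in the shell) such that every patched surgery 2-family `S`
over it (`S (R, t)` admissible, `= E t` off `e.far R`, `= G R` on `e.far R₀`, jointly smooth — exactly the output
of the LANDED patching engine `stub_probePatch`, p116096) has a threshold `ρ`, continuous on `t ≠ 0`, above which
every member lies in the disprover's `Negative.coreSet X` (MGHD exists; every MGHD carries an honest `C⁴`
fixed-radius decomposition of its self-determined exterior WITH ONE ATLAS AT INFINITY) — the final-state core on
Schwarzschild-ended data whose far pulse has mass `m R ≥ ηR` (a broad weak pulse of fixed relative amplitude: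
a large-data robustness statement, where the shrinking schedule asks a small-data one).  Proof: for an exceptional
admissible `d` take the family, the probe, the patched surgery (`stub_probePatch`), the threshold, and the typed
smooth injective curve above it (`stub_thresholdJunction`, p116598); its members are admissible and, for `c ≠ 0`,
in `coreSet ⊆ settlingSet` (CERT, `Negative.coreSet_subset_settlingSet`) — codimension `1` (`Negative.crux_iff`).

References: `Theses/SwallowTheDatum.lean` (item 15427); Mao–Oh–Tao arXiv:2308.13031 Thm 1.7, Rem 1.9; Christodoulou,
CQG 16 (1999) A23, p. A24; Dafermos–Luk arXiv:1710.01722, Conjecture 1.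
-/

-- the doubled `FinalStateConjecture` path component is the summit/problem naming scheme, not a mistake
set_option linter.dupNamespace false

noncomputable section

namespace Summit.FinalStateConjecture.FinalStateConjecture.Theorems.StarvedNecks.FarFieldSurgery

open scoped Manifold ContDiff Topology
open Set Filter Function Literature.Geometry.Lorentzian
open Summit.FinalStateConjecture.FinalStateConjecture.Theorems.SwallowTheDatum.ParametricKerrBurial
  (SmoothSectionsOn AgreeAt IsExactSchwarzschildBeyond)
open Summit.FinalStateConjecture.FinalStateConjecture.Theorems.HonestFixedRadiusSettling.Negative
  (settlingSet coreSet coreSet_subset_settlingSet)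
open Summit.FinalStateConjecture.FinalStateConjecture.Theses.StarvedNecks (HonestFixedRadiusSettling)

/-- **THE SECOND REDUCTION of the crux by far-field surgery, growing-mass schedule.**
`StarvedNecks.HonestFixedRadiusSettling` follows from (A″) the per-datum conclusion of SwallowTheDatum's
`FarAnnulusGluing` (stmt-15427, verbatim over the tree abbreviations) and (D″) STABLE UNFOLDING WITH ONE ATLAS
ALONG EVERY SUCH FAMILY: for every admissible datum and every far-gluing family `(η, e, R⋆, m, G)` of it, an
interior probe along `e` below `R⋆` with an injective marker such that every patched surgery 2-family over it has
a threshold above which every member lies in `Negative.coreSet X`.  Uses the LANDED `stub_probePatch` (p116096)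
and `stub_thresholdJunction` (p116598) and CERT (`Negative.coreSet_subset_settlingSet`). Christodoulou, CQG 16
(1999) A23, p. A24 (the genericity notion). [folklore] -/
theorem honestFixedRadiusSettling_of_farAnnulusGluing :
    (∀ (X : Type) [TopologicalSpace X] [ChartedSpace E3 X] [IsManifold (𝓡 3) ∞ X] [T2Space X]
      [SecondCountableTopology X] [ConnectedSpace X], ∀ d ∈ admissibleVacuumData X,
      ∃ (η : ℝ) (e : AFEnd X) (Rstar : ℝ) (m : ℝ → ℝ) (G : ℝ → InitialDataSet (𝓡 3) X),
        0 < η ∧ e.IsSoleEnd ∧ e.R < Rstar ∧ ContDiff ℝ ∞ m ∧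
        SmoothSectionsOn 𝓘(ℝ, ℝ) G {p : ℝ × X | Rstar < p.1} ∧
        ∀ R : ℝ, Rstar < R → G R ∈ admissibleVacuumData X ∧ (∀ x ∉ e.far R, AgreeAt (G R) d x) ∧
          η * R ≤ m R ∧ IsExactSchwarzschildBeyond e (G R) (m R) (32 * R)) →
    (∀ (X : Type) [TopologicalSpace X] [ChartedSpace E3 X] [IsManifold (𝓡 3) ∞ X] [T2Space X]
      [SecondCountableTopology X] [ConnectedSpace X], ∀ d ∈ admissibleVacuumData X,
      ∀ (η : ℝ) (e : AFEnd X) (Rstar : ℝ) (m : ℝ → ℝ) (G : ℝ → InitialDataSet (𝓡 3) X),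
        0 < η → e.IsSoleEnd → e.R < Rstar → ContDiff ℝ ∞ m →
        SmoothSectionsOn 𝓘(ℝ, ℝ) G {p : ℝ × X | Rstar < p.1} →
        (∀ R : ℝ, Rstar < R → G R ∈ admissibleVacuumData X ∧ (∀ x ∉ e.far R, AgreeAt (G R) d x) ∧
          η * R ≤ m R ∧ IsExactSchwarzschildBeyond e (G R) (m R) (32 * R)) →
        ∃ (R₀ : ℝ) (E : ℝ → InitialDataSet (𝓡 3) X) (x₀ : X) (v₀ : TangentSpace (𝓡 3) x₀),
          e.R < R₀ ∧ R₀ < Rstar ∧ SmoothSectionsOn 𝓘(ℝ, ℝ) E (Set.univ : Set (ℝ × X)) ∧ E 0 = d ∧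
          (∀ t : ℝ, E t ∈ admissibleVacuumData X) ∧ (∀ t : ℝ, ∀ x ∈ e.far R₀, AgreeAt (E t) d x) ∧
          x₀ ∉ e.far R₀ ∧ Set.InjOn (fun t : ℝ ↦ (E t).h.inner x₀ v₀ v₀) (Set.Ioo (-1) 1) ∧
          ∀ S : ℝ × ℝ → InitialDataSet (𝓡 3) X,
            SmoothSectionsOn (𝓘(ℝ, ℝ).prod 𝓘(ℝ, ℝ)) S {p : (ℝ × ℝ) × X | Rstar < p.1.1} →
            (∀ R t : ℝ, Rstar < R →
              S (R, t) ∈ admissibleVacuumData X ∧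
              (∀ x ∉ e.far R, AgreeAt (S (R, t)) (E t) x) ∧
              (∀ x ∈ e.far R₀, AgreeAt (S (R, t)) (G R) x)) →
            ∃ ρ : ℝ → ℝ, ContinuousOn ρ {t : ℝ | t ≠ 0} ∧
              ∀ R t : ℝ, Rstar < R → ρ t ≤ R → t ≠ 0 → |t| < 1 → S (R, t) ∈ coreSet X) →
    HonestFixedRadiusSettling := by
  intro hA hD
  rw [Summit.FinalStateConjecture.FinalStateConjecture.Theorems.HonestFixedRadiusSettling.Negative.crux_iff]
  intro X _ _ _ _ _ _ d hd
  obtain ⟨hdadm, -⟩ := hd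
  obtain ⟨η, e, Rstar, m, G, hη, hsole, heR, hm, hGsmooth, hGmem⟩ := hA X d hdadm
  obtain ⟨R₀, E, x₀, v₀, hR₀, hR₀star, hEsmooth, hE0, hEadm, hEd, hx₀, hmark, hrob⟩ :=
    hD X d hdadm η e Rstar m G hη hsole heR hm hGsmooth hGmem
  obtain ⟨S, hSsmooth, hS⟩ := stub_probePatch X d e R₀ Rstar E G hsole hR₀ hR₀star hEsmooth hEadm hEd
    hGsmooth fun R hR ↦ ⟨(hGmem R hR).1, (hGmem R hR).2.1⟩
  obtain ⟨ρ, hρ, hgood⟩ := hrob S hSsmooth hS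
  have hx₀' : x₀ ∉ e.far Rstar := fun h ↦ hx₀ (e.far_mono hR₀star.le h)
  obtain ⟨F, hF, hF0, hinj, hmem⟩ :=
    stub_thresholdJunction X d e Rstar S E x₀ v₀ ρ hSsmooth hEsmooth hE0
      (fun R t hR x hx ↦ (hS R t hR).2.1 x hx) hx₀' hmark hρ
  refine ⟨F, hF, hF0, hinj, fun c ↦ ?_, fun c hc hcE ↦ ?_⟩
  · by_cases hc : c = 0
    · subst hc
      rw [hF0]
      exact hdadm
    · obtain ⟨R, t, hR, -, -, -, hFc⟩ := hmem c hc
      rw [hFc]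
      exact (hS R t hR).1
  · obtain ⟨R, t, hR, hρR, ht, ht1, hFc⟩ := hmem c hc
    have hgoodc : F c ∈ settlingSet X := by
      rw [hFc]
      exact coreSet_subset_settlingSet (hgood R t hR hρR ht ht1)
    exact hcE.2 hgoodc

end Summit.FinalStateConjecture.FinalStateConjecture.Theorems.StarvedNecks.FarFieldSurgery

end
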